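import Mathlib
import HarnessLib

/-!
# Crux `NNMonotoneHard` (stmt-ValiantsHypothesis-11617), piece (B) of `Cruxes/NNMonotoneHard/PROOF-PLAN.md`:
# the adaptive forbidden-pattern test lemma

A counting lemma about words `v : Fin N → Bool` (uniform measure on `{U,D}^N`): fix a set `P` of
positions `p ≥ 1`, pairwise at distance `≥ 2`, and for each `p ∈ P` a "forbidden pattern"
`π p v ∈ Bool × Bool` that depends on `v` only through the STRICT PAST of the pair `{p-1, p}`
(the letters `v i`, `i + 1 < p`).  Then the number of words avoiding every forbidden pattern on its
pair, `(v (p-1), v p) ≠ π p v` for all `p ∈ P`, is exactly `(3/4)^{|P|} · 2^N`: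

* `card_filter_avoid_mul_four_pow` — `#{v : avoids} · 4^{|P|} = 3^{|P|} · 2^N`;
* `card_filter_avoid_le` — the same as the inequality used downstream.

This is the "supermartingale" behind the cost `3/4` per colour-run boundary in the thick-queue measure
argument (PROOF-PLAN.md (B)–(C)): each boundary of the colouring is a pair of positions on which a
word respecting the colouring must avoid one of the four letter patterns, the pattern being dictated
by the colour of the front of the queue just before the pair, i.e. by the strict past.  Proof:
induction on `P` through its maximum `a` (`Finset.induction_on_max`): the avoidance conditions for
`P \ {a}` and the pattern `π a` do not see the letters at `a-1, a`, so on each fibre of "forget the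
letters at `a-1, a`" exactly `3` of the `4` words avoid `π a`.

Honest framing: elementary counting; nothing here is specific to matchings, and VP ≠ VNP is not
moved by anything in this file.  No definitions, no named facts.
-/

-- Sub = Summit single-conjunct layout: the duplicated namespace component is mandated by the tree.
set_option linter.dupNamespace false

namespace Summit.ValiantsHypothesis.ValiantsHypothesis.Theorems.FifoMatching.NNMonotoneHard

open Finset

variable {N : ℕ}

/-- **The adaptive forbidden-pattern test lemma (exact count).**  Let `P` be a set of positions
`p` of `Fin N` with `1 ≤ p`, pairwise `≥ 2` apart, and let `π p v : Bool × Bool` depend on the word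
`v` only through the letters `v i` with `i + 1 < p`.  Then
`#{v : Fin N → Bool | ∀ p ∈ P, (v (p-1), v p) ≠ π p v} · 4^{|P|} = 3^{|P|} · 2^N`. [folklore] -/
theorem card_filter_avoid_mul_four_pow (P : Finset (Fin N)) (hP : ∀ p ∈ P, 1 ≤ (p : ℕ))
    (hsep : ∀ p ∈ P, ∀ q ∈ P, p < q → (p : ℕ) + 2 ≤ q)
    (π : Fin N → (Fin N → Bool) → Bool × Bool)
    (hπ : ∀ p ∈ P, ∀ v w : Fin N → Bool,
      (∀ i : Fin N, (i : ℕ) + 1 < p → v i = w i) → π p v = π p w) :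
    (univ.filter fun v : Fin N → Bool => ∀ p ∈ P,
        (v ⟨(p : ℕ) - 1, lt_of_le_of_lt (Nat.sub_le _ _) p.isLt⟩, v p) ≠ π p v).card * 4 ^ P.card
      = 3 ^ P.card * 2 ^ N := by
  classical
  -- induction on `P` through its maximum
  induction P using Finset.induction_on_max with
  | empty =>
    simp only [notMem_empty, IsEmpty.forall_iff, implies_true, filter_true_of_mem, mem_univ,
      card_univ, card_empty, pow_zero, mul_one, one_mul, Fintype.card_fun, Fintype.card_bool,
      Fintype.card_fin]
  | insert a s hlt ih =>
    -- hypotheses for `s`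
    have hPs : ∀ p ∈ s, 1 ≤ (p : ℕ) := fun p hp => hP p (mem_insert_of_mem hp)
    have hseps : ∀ p ∈ s, ∀ q ∈ s, p < q → (p : ℕ) + 2 ≤ q := fun p hp q hq =>
      hsep p (mem_insert_of_mem hp) q (mem_insert_of_mem hq)
    have hπs : ∀ p ∈ s, ∀ v w : Fin N → Bool,
        (∀ i : Fin N, (i : ℕ) + 1 < p → v i = w i) → π p v = π p w := fun p hp =>
      hπ p (mem_insert_of_mem hp)
    have IH := ih hPs hseps hπs
    have ha1 : 1 ≤ (a : ℕ) := hP a (mem_insert_self a s)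
    have has : a ∉ s := fun h => lt_irrefl a (hlt a h)
    have hsa : ∀ p ∈ s, (p : ℕ) + 2 ≤ a := fun p hp =>
      hsep p (mem_insert_of_mem hp) a (mem_insert_self a s) (hlt p hp)
    -- the two positions of the new pair
    set a' : Fin N := ⟨(a : ℕ) - 1, lt_of_le_of_lt (Nat.sub_le _ _) a.isLt⟩ with ha'
    have hne : a' ≠ a := by
      intro h
      have := congrArg Fin.val h
      simp [ha'] at this
      omega
    -- the predicates
    set As : (Fin N → Bool) → Prop := fun v => ∀ p ∈ s,
        (v ⟨(p : ℕ) - 1, lt_of_le_of_lt (Nat.sub_le _ _) p.isLt⟩, v p) ≠ π p v with hAs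
    set Av : (Fin N → Bool) → Prop := fun v => (v a', v a) ≠ π a v with hAv
    have hsplit : (univ.filter fun v : Fin N → Bool => ∀ p ∈ insert a s,
        (v ⟨(p : ℕ) - 1, lt_of_le_of_lt (Nat.sub_le _ _) p.isLt⟩, v p) ≠ π p v)
        = univ.filter fun v => As v ∧ Av v := by
      ext v
      simp only [mem_filter, mem_univ, true_and, forall_mem_insert, hAs, hAv]
      tauto
    rw [hsplit, card_insert_of_notMem has, pow_succ, ← mul_assoc]
    -- forgetting the letters at `a', a`
    set e : (Fin N → Bool) → (Fin N → Bool) := fun v =>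
      Function.update (Function.update v a' false) a false with he
    set g : (Fin N → Bool) → Bool × Bool → (Fin N → Bool) := fun w xy =>
      Function.update (Function.update w a' xy.1) a xy.2 with hg
    have hg_inj : ∀ w, Function.Injective (g w) := by
      intro w xy xy' h
      have h1 := congrFun h a
      have h2 := congrFun h a'
      simp only [hg, Function.update_self, Function.update_of_ne hne] at h1 h2
      exact Prod.ext h2 h1
    have hg_apply_a : ∀ w xy, g w xy a = xy.2 := fun w xy => by simp [hg]
    have hg_apply_a' : ∀ w xy, g w xy a' = xy.1 := fun w xy => by
      simp [hg, Function.update_of_ne hne]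
    have hg_apply_of_ne : ∀ w xy i, i ≠ a' → i ≠ a → g w xy i = w i := fun w xy i hi' hi => by
      simp [hg, Function.update_of_ne hi, Function.update_of_ne hi']
    -- the image of `e`
    set T : Finset (Fin N → Bool) := univ.filter fun w => w a' = false ∧ w a = false with hT
    have he_mem : ∀ v, e v ∈ T := fun v => by
      simp [hT, he, Function.update_of_ne hne]
    have he_g : ∀ w ∈ T, ∀ xy, e (g w xy) = w := by
      intro w hw xy
      simp only [hT, mem_filter, mem_univ, true_and] at hw
      funext i
      by_cases hi : i = a
      · subst hi; simp [he, hw.2]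
      · by_cases hi' : i = a'
        · subst hi'; simp [he, Function.update_of_ne hne, hw.1]
        · simp [he, hg, Function.update_of_ne hi, Function.update_of_ne hi']
    have hg_e : ∀ v, g (e v) (v a', v a) = v := by
      intro v
      funext i
      by_cases hi : i = a
      · subst hi; simp [hg]
      · by_cases hi' : i = a'
        · subst hi'; simp [hg, he, Function.update_of_ne hne]
        · simp [he, hg, Function.update_of_ne hi, Function.update_of_ne hi']
    -- the fibre of `e` over `w ∈ T` is `g w '' (Bool × Bool)`
    have hfibre : ∀ w ∈ T, (univ.filter fun v => e v = w) = univ.image (g w) := by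
      intro w hw
      ext v
      simp only [mem_filter, mem_univ, true_and, mem_image]
      constructor
      · intro hv
        exact ⟨(v a', v a), by rw [← hv]; exact hg_e v⟩
      · rintro ⟨xy, rfl⟩
        exact he_g w hw xy
    -- invariance of `As` and of `π a` along fibres
    have hAs_g : ∀ w xy, As (g w xy) ↔ As w := by
      intro w xy
      have hcoord : ∀ p ∈ s, ∀ i : Fin N, (i : ℕ) ≤ p → g w xy i = w i := by
        intro p hp i hi
        have h2 := hsa p hp
        apply hg_apply_of_ne
        · intro h; have := congrArg Fin.val h; simp [ha'] at this; omega
        · intro h; have := congrArg Fin.val h; omega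
      simp only [hAs]
      refine forall₂_congr fun p hp => ?_
      rw [hcoord p hp _ (Nat.sub_le _ _), hcoord p hp p le_rfl,
        hπs p hp (g w xy) w fun i hi => hcoord p hp i (by omega)]
    have hπa_g : ∀ w xy, π a (g w xy) = π a w := by
      intro w xy
      apply hπ a (mem_insert_self a s)
      intro i hi
      apply hg_apply_of_ne
      · intro h; have := congrArg Fin.val h; simp [ha'] at this; omega
      · intro h; have := congrArg Fin.val h; omega
    -- count `As` fibrewise: each fibre over `w ∈ T` with `As w` has 4 elements
    have hcountAs : (univ.filter fun v => As v).card = 4 * (T.filter fun w => As w).card := by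
      rw [card_eq_sum_card_fiberwise (f := e) (t := T) (fun v _ => he_mem v)]
      rw [show (4 : ℕ) * (T.filter fun w => As w).card
          = ∑ w ∈ T, if As w then 4 else 0 by
        rw [← sum_filter, sum_const, smul_eq_mul, mul_comm]]
      refine sum_congr rfl fun w hw => ?_
      have : ((univ.filter fun v => As v).filter fun v => e v = w)
          = (univ.filter fun v => e v = w).filter fun v => As v := by
        ext v; simp only [mem_filter, mem_univ, true_and]; tauto
      rw [this, hfibre w hw, filter_image]
      split_ifs with hAw
      · rw [filter_true_of_mem (fun xy _ => (hAs_g w xy).2 hAw), card_image_of_injective _ (hg_inj w)]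
        simp
      · rw [filter_false_of_mem (fun xy _ => fun h => hAw ((hAs_g w xy).1 h))]
        simp
    -- count `As ∧ Av` fibrewise: each such fibre has exactly 3 elements avoiding `π a w`
    have hcountAv : (univ.filter fun v => As v ∧ Av v).card
        = 3 * (T.filter fun w => As w).card := by
      rw [card_eq_sum_card_fiberwise (f := e) (t := T) (fun v _ => he_mem v)]
      rw [show (3 : ℕ) * (T.filter fun w => As w).card
          = ∑ w ∈ T, if As w then 3 else 0 by
        rw [← sum_filter, sum_const, smul_eq_mul, mul_comm]]
      refine sum_congr rfl fun w hw => ?_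
      have : ((univ.filter fun v => As v ∧ Av v).filter fun v => e v = w)
          = (univ.filter fun v => e v = w).filter fun v => As v ∧ Av v := by
        ext v; simp only [mem_filter, mem_univ, true_and]; tauto
      rw [this, hfibre w hw, filter_image]
      split_ifs with hAw
      · have hset : (univ.filter fun xy : Bool × Bool => As (g w xy) ∧ Av (g w xy))
            = univ.erase (π a w) := by
          ext xy
          simp only [mem_filter, mem_univ, true_and, mem_erase, and_true, hAv,
            hg_apply_a, hg_apply_a', hπa_g, (hAs_g w xy), hAw, ne_eq]
        rw [card_image_of_injective _ (hg_inj w), hset, card_erase_of_mem (mem_univ _)]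
        simp
      · rw [filter_false_of_mem (fun xy _ => fun h => hAw ((hAs_g w xy).1 h.1))]
        simp
    -- conclude
    have IH' : (univ.filter fun v => As v).card * 4 ^ s.card = 3 ^ s.card * 2 ^ N := IH
    rw [hcountAs] at IH'
    rw [hcountAv]
    calc 3 * (T.filter fun w => As w).card * 4 ^ s.card * 4
        = 3 * (4 * (T.filter fun w => As w).card * 4 ^ s.card) := by ring
      _ = 3 * (3 ^ s.card * 2 ^ N) := by rw [IH']
      _ = 3 ^ s.card * 3 * 2 ^ N := by ring

/-- **The test lemma as an inequality**: under the uniform measure on words, avoiding `J = |P|`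
adaptively forbidden patterns on fixed, pairwise separated pairs has probability at most `(3/4)^J`,
i.e. `#{v : avoids} · 4^J ≤ 3^J · 2^N`. [folklore] -/
theorem card_filter_avoid_le (P : Finset (Fin N)) (hP : ∀ p ∈ P, 1 ≤ (p : ℕ))
    (hsep : ∀ p ∈ P, ∀ q ∈ P, p < q → (p : ℕ) + 2 ≤ q)
    (π : Fin N → (Fin N → Bool) → Bool × Bool)
    (hπ : ∀ p ∈ P, ∀ v w : Fin N → Bool,
      (∀ i : Fin N, (i : ℕ) + 1 < p → v i = w i) → π p v = π p w)
    (A : Finset (Fin N → Bool))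
    (hA : ∀ v ∈ A, ∀ p ∈ P, (v ⟨(p : ℕ) - 1, lt_of_le_of_lt (Nat.sub_le _ _) p.isLt⟩, v p) ≠ π p v) :
    A.card * 4 ^ P.card ≤ 3 ^ P.card * 2 ^ N := by
  classical
  rw [← card_filter_avoid_mul_four_pow P hP hsep π hπ]
  refine Nat.mul_le_mul_right _ (card_le_card fun v hv => ?_)
  simp only [mem_filter, mem_univ, true_and]
  exact hA v hv

end Summit.ValiantsHypothesis.ValiantsHypothesis.Theorems.FifoMatching.NNMonotoneHard
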